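import Summits.NavierStokesRegularity.NavierStokesRegularity.Theses.PerpetualPump

/-!
# NavierStokesRegularity — route `PerpetualPump`, glue `ThesisOfNoAveragedTypeIBlowup`

Settles `stmt-NavierStokesRegularity-14796` (support glue of route PerpetualPump):

  `¬ AveragedTypeIBlowup → Thesis`

Pure classical logic. The crux `AveragedTypeIBlowup` (stmt-NavierStokesRegularity-1835, the PDE
perpetual pump: a symmetric averaging datum with cancellation, a Schwartz divergence-free datum and
an `H¹⁰_df` mild solution on `[0,T)` at the Type-I rate with NO mild extension past `T`) is, word
for word, the negation of the route target `Thesis` (abstract Type-I exclusion over Tao's averaging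
class: every such solution extends). Hence refuting the crux proves the `closes` hypothesis
`Thesis` — this is the cone edge `AveragedTypeIBlowup ⟶ Thesis` ON THE NEGATIVE SIDE (polarity:
crux REFUTED ⇒ `Thesis`; crux PROVED ⇒ `¬ Thesis`, route broken by design). The converse direction
is in tree as
`Summit.NavierStokesRegularity.NavierStokesRegularity.Theorems.AveragedTypeIBlowup.Negative.averagedTypeIBlowup_iff_not_thesis`
(`NSReduction.lean`); the proof below is written out directly so that this file depends on the
route file only. Nothing here is new mathematics.
-/

namespace Summit.NavierStokesRegularity.NavierStokesRegularity.Theorems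

open Summit.NavierStokesRegularity.NavierStokesRegularity.Theses

/-- Glue of route PerpetualPump (`stmt-NavierStokesRegularity-14796`):
`¬ AveragedTypeIBlowup → Thesis`. Classical logic: fix the data of `Thesis` (averaging datum `𝒜`,
symmetric with cancellation; Schwartz divergence-free `u₀`; `T > 0`; a mild solution `u` on
`[0,T)` at the Type-I rate); if `u` had no mild extension past `T`, these data would witness
`AveragedTypeIBlowup`, contradicting the hypothesis. [folklore] -/
theorem perpetualPump_thesisOfNoAveragedTypeIBlowup_proof :
    PerpetualPump.ThesisOfNoAveragedTypeIBlowup := by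
  unfold PerpetualPump.ThesisOfNoAveragedTypeIBlowup PerpetualPump.AveragedTypeIBlowup
    PerpetualPump.Thesis
  intro hno 𝒜 hs hc u₀ hdiv T hT u hmild hrate
  by_contra hext
  exact hno ⟨𝒜, hs, hc, u₀, hdiv, T, hT, u, hmild, hrate, hext⟩

end Summit.NavierStokesRegularity.NavierStokesRegularity.Theorems
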